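import Literature.Geometry.Riemannian.MetricFlowFDistanceExtendAux3
import Literature.Geometry.Riemannian.MetricFlowFConvergenceTimewise
import HarnessLib

/-!
# Extending `𝔽`-distance estimates to larger time domains (Bamler 2023, §7.2, Lemma 7.?
# (arXiv v1 Lemma 160))

R. Bamler, *Compactness theory of the space of super Ricci flows*, Invent. Math. 233 (2023), §7.2,
Lemma 7.? (arXiv v1 Lemma 160): *"For every `H, V ≥ 0` and every function `b : (0,1] → (0,1]` there
is a function `δ_{H,V,b} : ℝ₊ → ℝ₊` such that the following holds. Let `r > 0` be a scale and
consider a subset `I₀ ⊂ I` of an interval `I ⊂ ℝ`. Consider two metric flow pairs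
`(𝒳^i, (μ^i_t)_{t ∈ I})`, `i = 1, 2`, representing classes in `𝔽^I_I(H, V, b, r)` and a
correspondence `ℭ₀` between `𝒳¹, 𝒳²` over `I₀`. Then there is a correspondence `ℭ` between
`𝒳¹, 𝒳²` over `I` such that `ℭ₀ = ℭ|_{I₀}` and such that the following is true: Assume that `ε > 0`
and that for `δ = δ_{H,V,b}(ε)` the following holds: `d_𝔽^{ℭ₀, I₀}((𝒳¹, (μ¹_t)), (𝒳², (μ²_t))) < δ r`.
Consider a subset `I₀ ⊂ I₁ ⊂ I` with `sup I₁ ∖ I₀ < sup I − ε r²`. Suppose that for any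
`t ∈ I₁ ∖ I₀` there is a minimal `t' ∈ (t, t + δr²] ∩ I₀` and this `t'` satisfies
`∫_{𝒳^i_{t'}}∫_{𝒳^i_{t'}} d^i_{t'} dμ^i_{t'} dμ^i_{t'} − ∫_{𝒳^i_t}∫_{𝒳^i_t} d^i_t dμ^i_t dμ^i_t ≤ δ r` for
`i = 1, 2`. Then over `I₁`, `d_𝔽^{ℭ|_{I₁}, I₁}((𝒳¹, (μ¹_t)), (𝒳², (μ²_t))) ≤ ε r`."*

This file proves the Lemma in the form consumed by the total-boundedness assembly of §7.3
(the `r = 1`, `J = I₁`, `E = ∅` case for metric flow pairs over `[a, T]` with compact time-slices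
— the time-slices of the metric flows of Ricci flows on compact manifolds — and a FINITE `I₀`):
for `H, V ≥ 0`, `ε > 0` there is `δ > 0` such that for `H`-concentrated pairs `P₁, P₂` defined over
`(a, T)` with `Var(μ^i_t) ≤ V`, a correspondence `ℭ₀` over `I₀` within which `δ` is admissible with
no exceptional times, and `I₀ ⊆ I₁ ⊆ (a, T)` such that every `t ∈ I₁ ∖ I₀` has `t + ε < T` and a
minimal `t' ∈ I₀ ∩ (t, t + δ]` with `∫∫ d_{t'} dμ^i_{t'} dμ^i_{t'} ≤ ∫∫ d_t dμ^i_t dμ^i_t + δ`, there is a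
correspondence `ℭ` over `I₁` within which `ε` is admissible with no exceptional times
(`MetricFlowPair.FDistAdmissibleWith P₁ P₂ ℭ ∅ I₁ ε`, hence `d_𝔽^{ℭ, I₁} ≤ ε`). The role of the
function `b` of the source (a lower mass-distribution bound of the class `𝔽(H, V, b, r)`) is played
by the mass-distribution Proposition of §4.1, which produces the bound from `H`-concentration and
`Var ≤ V` at the future time `t' + τ < T`; this is why `t + ε < T` is required (as in the source's
`sup I₁ ∖ I₀ < sup I − ε r²`).

Proof (source, followed): `MetricFlowFDistanceExtendAux1.lean` (the coupling (7.15), (7.16),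
(7.17)), `MetricFlowFDistanceExtendAux2.lean` (the final chain of inequalities),
`MetricFlowFDistanceExtendAux3.lean` (the spaces `Z̃^i` of §4.1/§4.2, their gluing with `Z_{t'}`,
the extended correspondence); here the choice of `δ = δ(H, V, ε)` (`exists_extension_parameters`)
and the assembly.

* `MetricFlow.exists_extension_parameters` — the bookkeeping `ε ↦ (η, ζ, τ, δ)` with
  `2√(Hδ) + 2Ψ(H, V, η) + δ ≤ ε`;
* `MetricFlowPair.exists_correspondence_extend_of_finite` — **Lemma 7.? (arXiv v1 Lemma 160)**.

## References

* R. H. Bamler, *Compactness theory of the space of super Ricci flows*, Invent. Math. 233 (2023),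
  1121–1277 (arXiv:2008.09298), §7.2, Lemma 7.? (arXiv v1 Lemma 160) and its proof. [Bamler2023]
-/

noncomputable section

open Set MeasureTheory ProbabilityTheory Filter TopologicalSpace Function Metric
open scoped Topology ENNReal NNReal ProbabilityTheory

namespace Literature.Geometry.Riemannian

universe u

/-! ### The choice of `δ(H, V, ε)` -/

namespace MetricFlow

/-- **The bookkeeping `ε ↦ δ_{H,V}(ε)` of the proof of Lemma 7.?** (the generic `Ψ(δ) → 0`): for
`H ≥ 0`, `V ∈ ℝ`, `ε > 0` there are `η, ζ, τ, δ > 0` with `ζ ≤ 1`, `η ≤ 1/2`, `δ, ζ ≤ η`,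
`8τH ≤ ζ³`, `δ + τ ≤ ε`, the §4.2 (b) constant `C(H, δ, ζ, β) ≤ η` for `β = Φ(−√(8V/(ζτ)))/2`, and
`2√(Hδ) + 2Ψ(H, V, η) + δ ≤ ε`: first `η` (continuity of `Ψ(H, V, ·)` at `0`), then `ζ := η/9`,
`τ := min(ε/2, ζ³/(8(H + 1)))`, and finally `δ` (continuity at `0` of `C(H, ·, ζ, β)`, whose value at
`0` is `8ζ < η`, and of `2√(H·) + ·`). [cite: Bamler2023, §7.2, Lemma 7.? (arXiv v1 Lemma 160), proof] -/
theorem exists_extension_parameters {H ε : ℝ} (V : ℝ) (hH : 0 ≤ H) (hε : 0 < ε) :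
    ∃ η ζ τ δ : ℝ, 0 < δ ∧ 0 < ζ ∧ ζ ≤ 1 ∧ 0 < τ ∧ η ≤ 1 / 2 ∧ δ ≤ η ∧ ζ ≤ η ∧
      8 * (τ * H) ≤ ζ ^ 3 ∧ δ + τ ≤ ε ∧
      ((δ / (2 * ζ) + 3 * Real.sqrt (H * (δ / (4 * ζ ^ 2)))) /
          (Phi (-Real.sqrt (8 * V / (ζ * τ))) / 2) ^ 2 + 4) * (2 * ζ) ≤ η ∧
      2 * Real.sqrt (H * δ) + 2 * sliceUnionBound H V η + δ ≤ ε := by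
  -- Step 1: `η`
  obtain ⟨η, hηΨ, hη0, hη2⟩ : ∃ η, sliceUnionBound H V η < ε / 4 ∧ 0 < η ∧ η < 1 / 2 := by
    have h0 : (fun η ↦ sliceUnionBound H V η) 0 < ε / 4 := by
      simp only [sliceUnionBound_zero]
      positivity
    have h1 : ∀ᶠ η in 𝓝 (0 : ℝ), sliceUnionBound H V η < ε / 4 :=
      Filter.Tendsto.eventually_lt_const h0 (continuous_sliceUnionBound H V).continuousAt
    have h2 : ∀ᶠ η in 𝓝[>] (0 : ℝ), η ∈ Ioo (0 : ℝ) (1 / 2) := Ioo_mem_nhdsGT (by norm_num)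
    obtain ⟨η, h, h'⟩ := ((h1.filter_mono nhdsWithin_le_nhds).and h2).exists
    exact ⟨η, h, h'.1, h'.2⟩
  -- Step 2: `ζ`, `τ`, `β`
  set ζ : ℝ := η / 9 with hζ_def
  have hζ0 : 0 < ζ := by positivity
  set τ : ℝ := min (ε / 2) (ζ ^ 3 / (8 * (H + 1))) with hτ_def
  have hτ0 : 0 < τ := lt_min (by positivity) (by positivity)
  have hτε : τ ≤ ε / 2 := min_le_left _ _
  have hτH : 8 * (τ * H) ≤ ζ ^ 3 := by
    have h1 : τ ≤ ζ ^ 3 / (8 * (H + 1)) := min_le_right _ _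
    have h3 : τ * (8 * (H + 1)) ≤ ζ ^ 3 := (le_div_iff₀ (by positivity)).1 h1
    nlinarith [hτ0.le]
  set β : ℝ := Phi (-Real.sqrt (8 * V / (ζ * τ))) / 2 with hβ_def
  have hβ : 0 < β := half_pos (Phi_pos _)
  -- Step 3: `δ`
  set g : ℝ → ℝ := fun δ ↦
    ((δ / (2 * ζ) + 3 * Real.sqrt (H * (δ / (4 * ζ ^ 2)))) / β ^ 2 + 4) * (2 * ζ) with hg_def
  have hgc : Continuous g := by
    simp only [hg_def]
    fun_prop
  have hg0 : g 0 < η := by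
    simp only [hg_def, zero_div, mul_zero, Real.sqrt_zero, zero_add, add_zero]
    rw [hζ_def]
    linarith
  set k : ℝ → ℝ := fun δ ↦ 2 * Real.sqrt (H * δ) + δ with hk_def
  have hkc : Continuous k := by
    simp only [hk_def]
    fun_prop
  have hk0 : k 0 < ε / 2 := by
    simp only [hk_def, mul_zero, Real.sqrt_zero, add_zero]
    positivity
  obtain ⟨δ, hgδ, hkδ, hδ0, hδm⟩ : ∃ δ, g δ < η ∧ k δ < ε / 2 ∧ 0 < δ ∧ δ < min η (ε / 2) := by
    have h1 : ∀ᶠ δ in 𝓝 (0 : ℝ), g δ < η :=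
      Filter.Tendsto.eventually_lt_const hg0 hgc.continuousAt
    have h2 : ∀ᶠ δ in 𝓝 (0 : ℝ), k δ < ε / 2 :=
      Filter.Tendsto.eventually_lt_const hk0 hkc.continuousAt
    have h3 : ∀ᶠ δ in 𝓝[>] (0 : ℝ), δ ∈ Ioo (0 : ℝ) (min η (ε / 2)) :=
      Ioo_mem_nhdsGT (lt_min hη0 (by positivity))
    obtain ⟨δ, ⟨h, h'⟩, h''⟩ := (((h1.and h2).filter_mono nhdsWithin_le_nhds).and h3).exists
    exact ⟨δ, h, h', h''.1, h''.2⟩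
  have hδη : δ ≤ η := hδm.le.trans (min_le_left _ _)
  have hδε : δ ≤ ε / 2 := hδm.le.trans (min_le_right _ _)
  refine ⟨η, ζ, τ, δ, hδ0, hζ0, by linarith, hτ0, hη2.le, hδη, by linarith, hτH, by linarith,
    hgδ.le, ?_⟩
  have hk : k δ = 2 * Real.sqrt (H * δ) + δ := rfl
  linarith

end MetricFlow

/-! ### Lemma 7.? (arXiv v1 Lemma 160) -/

namespace MetricFlowPair

open MetricFlow

/-- **Bamler 2023, Lemma 7.? (arXiv v1 Lemma 160): extending `𝔽`-distance estimates to larger time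
domains** (`r = 1`, `J = I₁`, `E = ∅`, finite `I₀`, metric flow pairs over `[a, T]` with compact
time-slices). For `H, V ≥ 0` and `ε > 0` there is `δ = δ(H, V, ε) > 0` such that: if `P₁, P₂` are
`H`-concentrated metric flow pairs over `[a, T]`, defined over `(a, T)`, with `Var(μ^i_t) ≤ V`, if
`ℭ₀` is a correspondence over the finite set `I₀` within which `δ` is admissible for `d_𝔽^{ℭ₀, I₀}`
with no exceptional times, and if `I₀ ⊆ I₁ ⊆ (a, T)` is such that every `t ∈ I₁ ∖ I₀` satisfies
`t + ε < T` and has a minimal `t' ∈ I₀ ∩ (t, t + δ]` at which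
`∫∫ d_{t'} dμ^i_{t'} dμ^i_{t'} ≤ ∫∫ d_t dμ^i_t dμ^i_t + δ` (`i = 1, 2`), then there is a correspondence `ℭ`
over `I₁` within which `ε` is admissible for `d_𝔽^{ℭ, I₁}` with no exceptional times. Proof as
printed: the comparison spaces `Z_t ⊇ Z_{t'}` (glued from the spaces `Z̃^i = 𝒳^i_t ⊔ 𝒳^i_{t'}` of
§4.1/§4.2 and `Z_{t'}`), the couplings `q_t := ∫ (ν¹_{x¹;t} ⊗ ν²_{x²;t}) dq_{t'}` (7.15), and the
estimate (7.16)–(7.17) giving `∫ d_{W₁}^{Z_s}(…) dq_t ≤ 2√(Hδ) + 2Ψ + δ ≤ ε`.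
[cite: Bamler2023, §7.2, Lemma 7.? (arXiv v1 Lemma 160)] -/
theorem exists_correspondence_extend_of_finite :
    ∀ (H V ε : ℝ), 0 ≤ H → 0 ≤ V → 0 < ε → ∃ δ : ℝ, 0 < δ ∧
      ∀ {a T : ℝ} (P₁ P₂ : MetricFlowPair.{u} (Set.Icc a T)),
        P₁.flow.IsHConcentrated H → P₂.flow.IsHConcentrated H →
        ∀ (h₁ : Set.Ioo a T ⊆ P₁.I') (h₂ : Set.Ioo a T ⊆ P₂.I'),
        (∀ t, variance (P₁.μ t) (P₁.μ t) ≤ ENNReal.ofReal V) →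
        (∀ t, variance (P₂.μ t) (P₂.μ t) ≤ ENNReal.ofReal V) →
        (∀ t, CompactSpace (P₁.flow.Slice t)) → (∀ t, CompactSpace (P₂.flow.Slice t)) →
        ∀ (I₀ : Finset ℝ) (I₁ : Set ℝ)
          (ℭ₀ : MetricFlow.Correspondence₂ P₁.flow P₂.flow (↑I₀ : Set ℝ)),
        MetricFlowPair.FDistAdmissibleWith P₁ P₂ ℭ₀ ∅ (↑I₀) δ →
        MeasurableSet I₁ → ∀ (hI₀ : (↑I₀ : Set ℝ) ⊆ I₁) (hI₁ : I₁ ⊆ Set.Ioo a T),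
        (∀ (t : ℝ) (ht : t ∈ I₁ \ ↑I₀), t + ε < T ∧ ∃ (t' : ℝ) (ht' : t' ∈ I₀),
            t < t' ∧ t' ≤ t + δ ∧ (∀ t'' ∈ I₀, t < t'' → t' ≤ t'') ∧
            P₁.flow.averageEDist (P₁.μ ⟨t', h₁ (hI₁ (hI₀ ht'))⟩) ≤
              P₁.flow.averageEDist (P₁.μ ⟨t, h₁ (hI₁ ht.1)⟩) + ENNReal.ofReal δ ∧
            P₂.flow.averageEDist (P₂.μ ⟨t', h₂ (hI₁ (hI₀ ht'))⟩) ≤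
              P₂.flow.averageEDist (P₂.μ ⟨t, h₂ (hI₁ ht.1)⟩) + ENNReal.ofReal δ) →
        ∃ ℭ : MetricFlow.Correspondence₂ P₁.flow P₂.flow I₁,
          MetricFlowPair.FDistAdmissibleWith P₁ P₂ ℭ ∅ I₁ ε := by
  intro H V ε hH hV hε
  obtain ⟨η, ζ, τ, δ, hδ, hζ, hζ1, hτ, hη2, hδη, hζη, hτH, hδτ, hC, htot⟩ :=
    exists_extension_parameters (V + 1) hH hε
  refine ⟨δ, hδ, ?_⟩
  intro a T P₁ P₂ hH₁ hH₂ h₁ h₂ hV₁ hV₂ hc₁ hc₂ I₀ I₁ ℭ₀ hadm₀ _ hI₀ hI₁ hnear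
  classical
  obtain ⟨_, _, _, _, hE₁, hE₂, _, q₀, hq₀, hint₀⟩ := hadm₀
  have hI₁₁ : I₁ ⊆ P₁.I' := fun t ht ↦ h₁ (hI₁ ht)
  have hI₁₂ : I₁ ⊆ P₂.I' := fun t ht ↦ h₂ (hI₁ ht)
  have hd : ∀ {u : ℝ}, u ∈ I₀ → u ∈ (↑I₀ : Set ℝ) \ ∅ := fun hu ↦ ⟨hu, fun h ↦ h⟩
  have hΨ0 : 0 ≤ sliceUnionBound H (V + 1) η := sliceUnionBound_nonneg H (V + 1) (hδ.le.trans hδη)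
  have hVle₁ : ∀ t, variance (P₁.μ t) (P₁.μ t) ≤ ENNReal.ofReal (V + 1) := fun t ↦
    (hV₁ t).trans (ENNReal.ofReal_le_ofReal (by linarith))
  have hVle₂ : ∀ t, variance (P₂.μ t) (P₂.μ t) ≤ ENNReal.ofReal (V + 1) := fun t ↦
    (hV₂ t).trans (ENNReal.ofReal_le_ofReal (by linarith))
  -- the near-future times `σ t ∈ I₀`, `t ∈ I₁` (`σ t = t` for `t ∈ I₀`)
  have key : ∀ t (ht : t ∈ I₁), ∃ (t' : ℝ) (ht' : t' ∈ I₀), t ≤ t' ∧ t' - t ≤ δ ∧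
      (∀ u ∈ I₀, t < u → t' ≤ u) ∧ (t ∈ I₀ → t' = t) ∧ (t ∉ I₀ → t' + τ < T) ∧
      P₁.flow.averageEDist (P₁.μ ⟨t', hI₁₁ (hI₀ ht')⟩) ≤
        P₁.flow.averageEDist (P₁.μ ⟨t, hI₁₁ ht⟩) + ENNReal.ofReal δ ∧
      P₂.flow.averageEDist (P₂.μ ⟨t', hI₁₂ (hI₀ ht')⟩) ≤
        P₂.flow.averageEDist (P₂.μ ⟨t, hI₁₂ ht⟩) + ENNReal.ofReal δ := by
    intro t ht
    by_cases h : t ∈ I₀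
    · exact ⟨t, h, le_rfl, by linarith, fun u _ hu ↦ hu.le, fun _ ↦ rfl, fun h' ↦ (h' h).elim,
        le_self_add, le_self_add⟩
    · obtain ⟨hT, t', ht', htt', ht'δ, hmin, havg₁, havg₂⟩ := hnear t ⟨ht, h⟩
      exact ⟨t', ht', htt'.le, by linarith, hmin, fun h' ↦ (h h').elim, fun _ ↦ by linarith,
        havg₁, havg₂⟩
  choose σ hσ₀ hσle hσδ hσmin hσeq hσT havg₁ havg₂ using key
  have hσσ : ∀ s (hs : s ∈ I₁) t (ht : t ∈ I₁), s ≤ t → σ s hs ≤ σ t ht := by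
    intro s hs t ht hst
    rcases lt_or_ge s (σ t ht) with hlt | hle
    · exact hσmin s hs _ (hσ₀ t ht) hlt
    · have heq : σ t ht = s := le_antisymm hle (hst.trans (hσle t ht))
      have hsI₀ : s ∈ I₀ := heq ▸ hσ₀ t ht
      rw [hσeq s hs hsI₀, ← heq]
  have hdom₁ : ∀ t (ht : t ∈ I₁), σ t ht ∈ ℭ₀.dom₁ := fun t ht ↦ hE₁ (hd (hσ₀ t ht))
  have hdom₂ : ∀ t (ht : t ∈ I₁), σ t ht ∈ ℭ₀.dom₂ := fun t ht ↦ hE₂ (hd (hσ₀ t ht))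
  -- the spaces `Z̃^i` of §4.1/§4.2 for `t ∉ I₀`
  have hex₁ : ∀ t (ht : t ∈ I₁), t ∉ I₀ →
      ∃ (W : Set (P₁.flow.Slice ⟨σ t ht, (ℭ₀.dom₁_subset (hdom₁ t ht)).1⟩))
        (h : CrossMetricSum.Hyp (P₁.flow.sliceCost ⟨t, hI₁₁ ht⟩
          ⟨σ t ht, (ℭ₀.dom₁_subset (hdom₁ t ht)).1⟩) W η),
        ∫⁻ x', ∫⁻ x, edist (CrossMetricSum.inl h x) (CrossMetricSum.inr h x')
          ∂(P₁.flow.condKernel x' ⟨t, hI₁₁ ht⟩)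
          ∂(P₁.μ ⟨σ t ht, (ℭ₀.dom₁_subset (hdom₁ t ht)).1⟩) ≤
          ENNReal.ofReal (sliceUnionBound H (V + 1) η) := by
    intro t ht hnot
    have hu : σ t ht + τ ∈ P₁.I' :=
      h₁ ⟨(hI₁ (hI₀ (hσ₀ t ht))).1.trans (lt_add_of_pos_right _ hτ), hσT t ht hnot⟩
    exact hH₁.exists_crossMetricSum_lintegral_le hH P₁.isConjugateHeatFlow (s := ⟨t, hI₁₁ ht⟩)
      (t := ⟨σ t ht, (ℭ₀.dom₁_subset (hdom₁ t ht)).1⟩) (u := ⟨σ t ht + τ, hu⟩) (hI₁₁ ht)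
      (ℭ₀.dom₁_subset (hdom₁ t ht)).1 hu (hσle t ht) hδ hζ hζ1 hτ rfl (by linarith) hτH hη2 hδη
      hζη hC (hσδ t ht) (hVle₁ _) (hVle₁ _) (havg₁ t ht)
  have hex₂ : ∀ t (ht : t ∈ I₁), t ∉ I₀ →
      ∃ (W : Set (P₂.flow.Slice ⟨σ t ht, (ℭ₀.dom₂_subset (hdom₂ t ht)).1⟩))
        (h : CrossMetricSum.Hyp (P₂.flow.sliceCost ⟨t, hI₁₂ ht⟩
          ⟨σ t ht, (ℭ₀.dom₂_subset (hdom₂ t ht)).1⟩) W η),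
        ∫⁻ x', ∫⁻ x, edist (CrossMetricSum.inl h x) (CrossMetricSum.inr h x')
          ∂(P₂.flow.condKernel x' ⟨t, hI₁₂ ht⟩)
          ∂(P₂.μ ⟨σ t ht, (ℭ₀.dom₂_subset (hdom₂ t ht)).1⟩) ≤
          ENNReal.ofReal (sliceUnionBound H (V + 1) η) := by
    intro t ht hnot
    have hu : σ t ht + τ ∈ P₂.I' :=
      h₂ ⟨(hI₁ (hI₀ (hσ₀ t ht))).1.trans (lt_add_of_pos_right _ hτ), hσT t ht hnot⟩
    exact hH₂.exists_crossMetricSum_lintegral_le hH P₂.isConjugateHeatFlow (s := ⟨t, hI₁₂ ht⟩)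
      (t := ⟨σ t ht, (ℭ₀.dom₂_subset (hdom₂ t ht)).1⟩) (u := ⟨σ t ht + τ, hu⟩) (hI₁₂ ht)
      (ℭ₀.dom₂_subset (hdom₂ t ht)).1 hu (hσle t ht) hδ hζ hζ1 hτ rfl (by linarith) hτH hη2 hδη
      hζη hC (hσδ t ht) (hVle₂ _) (hVle₂ _) (havg₂ t ht)
  -- the comparison spaces `Z_t`, `t ∈ I₁`, and the extended correspondence
  let D : ∀ t (ht : t ∈ I₁), ExtensionData P₁ P₂ ℭ₀ (sliceUnionBound H (V + 1) η) t (σ t ht)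
      (hI₁₁ ht) (hI₁₂ ht) (hdom₁ t ht) (hdom₂ t ht) := fun t ht ↦
    if h : t ∈ I₀ then
      ExtensionData.base (hI₁₁ ht) (hI₁₂ ht) (hdom₁ t ht) (hdom₂ t ht) (hσeq t ht h)
    else ExtensionData.ofExists (hI₁₁ ht) (hI₁₂ ht) (hdom₁ t ht) (hdom₂ t ht) (hex₁ t ht h)
      (hex₂ t ht h)
  refine ⟨extCorrespondence P₁ P₂ ℭ₀ (sliceUnionBound H (V + 1) η) hI₁₁ hI₁₂ σ hdom₁ hdom₂ D, hε,
    MeasurableSet.empty, empty_subset _, fun t ht ↦ ⟨ht, fun h ↦ h⟩, fun t ht ↦ ht.1,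
    fun t ht ↦ ht.1, by rw [measure_empty]; exact bot_le,
    fun t ht ↦ extCoupling P₁ P₂ (hI₁₁ ht.1) (hI₁₂ ht.1) (hI₁₁ (hI₀ (hσ₀ t ht.1)))
      (hI₁₂ (hI₀ (hσ₀ t ht.1))) (hσle t ht.1) (q₀ (σ t ht.1) (hd (hσ₀ t ht.1))),
    fun t ht ↦ isCoupling_extCoupling (hI₁₁ ht.1) (hI₁₂ ht.1) (hI₁₁ (hI₀ (hσ₀ t ht.1)))
      (hI₁₂ (hI₀ (hσ₀ t ht.1))) (hσle t ht.1) (hq₀ (σ t ht.1) (hd (hσ₀ t ht.1))),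
    fun s hs t ht hst ↦ ?_⟩
  -- the estimate for `s ≤ t` in `I₁`
  refine (lintegral_extCoupling_wassersteinW1_map_le hH hδ.le hΨ0 hH₁ hH₂ (hI₁₁ hs.1) (hI₁₂ hs.1)
    (ℭ₀.dom₁_subset (hdom₁ s hs.1)).1 (ℭ₀.dom₂_subset (hdom₂ s hs.1)).1 (hI₁₁ ht.1) (hI₁₂ ht.1)
    (hI₁₁ (hI₀ (hσ₀ t ht.1))) (hI₁₂ (hI₀ (hσ₀ t ht.1))) (hσle s hs.1) hst
    (hσσ s hs.1 t ht.1 hst) (hσle t ht.1) (hσδ t ht.1) (D s hs.1).isometry_φ₁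
    (D s hs.1).isometry_φ₂ (D s hs.1).isometry_ψ₁ (D s hs.1).isometry_ψ₂
    (ℭ₀.isometry₁ _ (hdom₁ s hs.1)) (ℭ₀.isometry₂ _ (hdom₂ s hs.1)) (D s hs.1).edist_ψ_le
    (D s hs.1).bound₁ (D s hs.1).bound₂ (hq₀ (σ t ht.1) (hd (hσ₀ t ht.1))) ?_).trans
    (ENNReal.ofReal_le_ofReal htot)
  exact hint₀ (σ s hs.1) (hd (hσ₀ s hs.1)) (σ t ht.1) (hd (hσ₀ t ht.1)) (hσσ s hs.1 t ht.1 hst)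

end MetricFlowPair

end Literature.Geometry.Riemannian

end
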